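import Literature.MathematicalPhysics.QuantumFieldTheory.Balaban1983to89.B8Eq156Prop4Rec
import Literature.MathematicalPhysics.QuantumFieldTheory.Balaban1983to89.B7LocalityRec
import Literature.MathematicalPhysics.QuantumFieldTheory.Balaban1983to89.B8Eq156KLevelLocal

/-!
# `Balaban1983to89.B8Eq156KLevelLocalRec` — [Balaban1985RegularSpaces] Sect. B p. 86: (1.56) «Q_j(U₀, ηA) = LʲηQ_jA + C_j(LʲηA), |C_j| ≦ C₂α₂²» and «|B₁| < 2dLα₁ + C₂α₂²»
# AT ONE BOND FROM THE DATA IN THE CENTRED BOX `B^j(c₋) ∪ B^j(c₊)` ONLY, and the k-level form «on Λ_j, j ≤ k», FOR THE RECORD's AVERAGING STRUCTURE ([Balaban1987RG1] (0.4)) —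
# the record twin of `B8Eq156KLevelLocal` §1–§4 (LEAD PEN dag-n05-e; R5-β, the localisation of dag-n05-c's `B8Eq156Prop4Rec`)

statement-level skeleton of published theorems with citation tags; proofs where landed; nothing here is a claim about the Yang–Mills mass gap

CITATION HEADER (lean-in-tree rule).  Cell `pub-ymgap` (HUMAN RULING D-0062), «N05-REC» road (director-ym №254∕№255; LEAD PEN dag-n05-e g37; dag-n05-c's `R5-CENSUS.md` sub-chain β).
[6] = [Balaban1985RegularSpaces] (1.56) p. 86, (1.40)–(1.42) p. 83, (1.3)∕(1.5) p. 77 (`paper:balaban1985-cmp99-regular-spaces`); [3] = [Balaban1985Averaging] p. 24 («this definition is local»),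
Prop. 4 p. 38, (122) p. 36; [I] = [Balaban1987RG1] (0.3)–(0.4) pp. 252–253.  `--kind proof --supports stmt-QuantumFields-20541` (K0⁷; count-neutral; no definition).  TOKEN MAP: the box
`B^j(c₋) ∪ B^j(c₊)` of `c = ⟨z, z + e_κ⟩` is the CENTRED `[L^jz − c_j𝟙, L^jz + L^je_κ + c_j𝟙]`, `c_j = (Lʲ − 1)∕2` (`BlockAveragingZd.ctrShift`; engine: `[loK, bondHiK]`); `logCovIter ∕ linCovIter ↦
logCovIterZ ∕ linCovIterZ`; `AvgClosed, C0 ↦ AvgClosedZ, C0Z`; the global (1.56) is dag-n05-c's `B8Eq156Prop4Rec.eq156_of_141` (record windows ×(1+4dL), director-ym №267); locality of `Q_j` is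
`B7LocalityRec.logCovIterZ_congr`, of the linear part §1 below (nesting `B7LocalityRec.inBox_nestZ`); class-0 `clampCfg ∕ insCfg ∕ bondsIn ∕ restr ∕ PlaqIn ∕ BondIn ∕ InAk ∕ BondTouches` BY NAME.

WHAT IS PROVED (sorry-free; odd `L = 2s + 1`, `s ≥ 1`).  §1 `linQcovZ_congr` (locality of the record's one-step linear part (122) «L(Q(V₀)A)_c»: bonds of the two-block box `[q − s𝟙, q + Le_κ + s𝟙]`),
★`linCovIterZ_congr` (LOCALITY OF THE RECORD's `LʲηQ_jA(c)`: `U₀` and `A` through the bonds of the centred `B^j(c₋) ∪ B^j(c₊)` only).  §2 ★★`eq156_loc` — (1.56) AT ONE BOND FROM BOX DATA: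
`|U₀(∂p) − 1| < α₀L^{−2j}` on the plaquettes of the box and `|A(b)| ≤ α₂(Lʲη)⁻¹` on its bonds ⇒ `‖Q_j(U₀, ηA)(c) − LʲηQ_jA(c)‖ ≤ C₂ᶻ(d, L, α₀)·α₂²`, `C₂ᶻ = (1+2gZ)·2·131072(d+1)²·KZ²·e^{4cZα₀}`
(the record's constant), under the record windows of `eq156_of_141`.  §3 `norm_B1_lt_loc` — «|B₁| < 2dLα₁ + C₂ᶻα₂²» at one bond.  §4 `norm_B1_lt_kLevel`, `wsup_B1_le_kLevel` — the k-level
form for a family `{Ω_j}` whose constraint bonds' centred boxes lie in `Ω_j` (hypothesis `hbox`), from `U₀ ∈ 𝔄_k({Ω_j}, α₀)` (`InAk`), (1.41) on the bonds touching `Ω_j`, (1.42) on `Λ_j`.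
NOT HERE: the engine's §5 (`hbox` from the CORNER block law `DomainSeq`); for the record `hbox` is the centred block law of the consumer's datum (`Node00.CubeB8DZ.blocks` ∕ `flmZ`).
HONEST SCOPE.  Localisation bookkeeping of dag-n05-c's global record (1.56); constants and windows exactly those of `B8Eq156Prop4Rec`; nothing of [3]∕[6]∕[I] asserted beyond it; `HThm4Rec`
UNDISCHARGED; N05 ∕ N07 NOT discharged; counts unmoved (typed 28∕28 · discharged 8∕28); one finite 𝕋⁴ programme at fixed ε — nothing continuum ∕ ℝ⁴ ∕ OS ∕ mass gap ∕ Clay.  No `def`, no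
`instance`, no `notation`, no `sorry`.
-/

noncomputable section

open scoped BigOperators
open NormedSpace

namespace Literature.MathematicalPhysics.QuantumFieldTheory.Balaban1983to89.B8Eq156KLevelLocalRec

open B7Prop1Explicit (U1 e)
open B7Prop1Local (InBox AgreeOn PlaqIn clampCfg clampCfg_agree clampCfg_mem pdev_clampCfg_le add_e_apply)
open B7Prop2Explicit (pdev c2')
open B7Prop3Flat (c3 insCfg)
open B7Prop5Flat (BondIn bondsIn restr insCfg_restr_of_mem mem_bondsIn agreeOn_insCfg_restr)
open B7Prop2Rec (AvgClosedZ C0Z)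
open B7Prop4GeneralLevelsRec (cZ gZ KZ)
open B7SectEFLinearisationRec (QcovZ linQcovZ logCovIterZ linCovIterZ linCovIterZ_succ)
open BlockAveragingZd (avgIterZ ctrShift)
open B8Lemma1NonAbelianRecLoops (pairLo pairHi)
open B7LocalityRec (QcovZ_congr logCovIterZ_congr avgIterZ_congr inBox_nestZ)
open B8Ineq132 (plaqF pdevOn_lt_of_forall InAk BondTouches)
open B8Eq146AExpansion (iEta)
open B8Eq155JBound (wsup wsup_le)
open B8Eq156Prop4Rec (eq156_of_141 B1_eq)

-- `Site` alone would resolve to the torus sites of `Setup.lean`; re-export the `ℤ^d` sites of `B7Prop1Explicit`.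
export B7Prop1Explicit (Site)

variable {d : ℕ}

/-! ## §1 Locality of the record's linear averaging `LʲηQ_jA` -/

section Locality

variable {𝔸 : Type*} [NormedRing 𝔸] [NormedAlgebra ℂ 𝔸] [CompleteSpace 𝔸]

/-- **Locality of the record's one-step linear part (122)** «L(Q(V₀)A)_c», jointly in `(V₀, A)`: bonds of `B(c₋) ∪ B(c₊) = [q − s𝟙, q + Le_κ + s𝟙]` (centred blocks) — it is the
`t`-derivative at `0` of `Q(V₀, tA, c)`, which is local by `B7LocalityRec.QcovZ_congr`. [cite: Balaban1985Averaging, (122) p.36, p.24; Balaban1987RG1, (0.4) p.253] -/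
theorem linQcovZ_congr {L s : ℕ} (hLs : L = 2 * s + 1) (q : Site d) (κ : Fin d) {V₀ V₀' : Site d → Fin d → 𝔸ˣ}
    {A A' : Site d → Fin d → 𝔸} (h₀ : AgreeOn (pairLo L q) (pairHi L q κ) V₀ V₀') (hA : AgreeOn (pairLo L q) (pairHi L q κ) A A') :
    linQcovZ L V₀ A q κ = linQcovZ L V₀' A' q κ := by
  unfold linQcovZ
  congr 1
  funext t
  exact QcovZ_congr hLs q κ h₀ fun x μ hx hxe => by
    show t • A x μ = t • A' x μ
    rw [hA x μ hx hxe]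

/-- ★ **LOCALITY OF THE RECORD's COMPOSITE LINEAR AVERAGING `LʲηQ_jA`** (p. 38 «Q_{j+1}(U₀) = Q(Ū₀ʲ)Q_j(U₀)», linear parts): `LʲηQ_jA(c)`, `c = ⟨z, z + e_κ⟩` of the `j`-th lattice, depends
only on the bond variables of `U₀` AND of `A` in the CENTRED `B^j(c₋) ∪ B^j(c₊) = [L^jz − c_j𝟙, L^jz + L^je_κ + c_j𝟙]` — the linear companion of `B7LocalityRec.logCovIterZ_congr`.
[cite: Balaban1985Averaging, p.24 (after (43)), p.38 (before (133)); Balaban1987RG1, (0.3)–(0.4) pp.252–253] -/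
theorem linCovIterZ_congr {L s : ℕ} (hLs : L = 2 * s + 1) :
    ∀ (j : ℕ) {U₀ U₀' : Site d → Fin d → 𝔸ˣ} {B B' : Site d → Fin d → 𝔸} (z : Site d) (κ : Fin d),
      AgreeOn (fun i => (L : ℤ) ^ j * z i - (ctrShift L j : ℤ)) (fun i => (L : ℤ) ^ j * z i + (ctrShift L j : ℤ) + if i = κ then (L : ℤ) ^ j else 0) U₀ U₀' →
      AgreeOn (fun i => (L : ℤ) ^ j * z i - (ctrShift L j : ℤ)) (fun i => (L : ℤ) ^ j * z i + (ctrShift L j : ℤ) + if i = κ then (L : ℤ) ^ j else 0) B B' →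
        linCovIterZ L U₀ B j z κ = linCovIterZ L U₀' B' j z κ
  | 0, U₀, U₀', B, B', z, κ, _, h => by
    have h0 : ctrShift L 0 = 0 := by simp [ctrShift]
    refine h z κ (fun i => ?_) (fun i => ?_)
    · simp only [h0, pow_zero, one_mul, Nat.cast_zero]; split_ifs <;> omega
    · simp only [h0, pow_zero, one_mul, Nat.cast_zero, add_e_apply]; split_ifs <;> omega
  | j + 1, U₀, U₀', B, B', z, κ, h₀, h => by
    rw [linCovIterZ_succ, linCovIterZ_succ]
    have hpair : ∀ {x : Site d} {μ : Fin d}, InBox (pairLo L ((L : ℤ) • z)) (pairHi L ((L : ℤ) • z) κ) x →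
        InBox (pairLo L ((L : ℤ) • z)) (pairHi L ((L : ℤ) • z) κ) (x + e μ) → ∀ {p : Site d},
        InBox (fun i => (L : ℤ) ^ j * x i - (ctrShift L j : ℤ)) (fun i => (L : ℤ) ^ j * x i + (ctrShift L j : ℤ) + if i = μ then (L : ℤ) ^ j else 0) p →
        InBox (fun i => (L : ℤ) ^ (j + 1) * z i - (ctrShift L (j + 1) : ℤ))
          (fun i => (L : ℤ) ^ (j + 1) * z i + (ctrShift L (j + 1) : ℤ) + if i = κ then (L : ℤ) ^ (j + 1) else 0) p :=
      fun hx hxe _ hp => inBox_nestZ hLs j z κ hx hxe hp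
    refine linQcovZ_congr hLs _ κ (fun x μ hx hxe => ?_) (fun x μ hx hxe => ?_)
    · exact avgIterZ_congr hLs j x μ fun p ν hp hpν => h₀ p ν (hpair hx hxe hp) (hpair hx hxe hpν)
    · exact linCovIterZ_congr hLs j x μ
        (fun p ν hp hpν => h₀ p ν (hpair hx hxe hp) (hpair hx hxe hpν))
        (fun p ν hp hpν => h p ν (hpair hx hxe hp) (hpair hx hxe hpν))

omit [NormedAlgebra ℂ 𝔸] [CompleteSpace 𝔸] in
/-- The restriction `A|_{box}` (zero outside the bonds of the box) is bounded by any common bound of `A` on the bonds of the box. [folklore] [cite: Balaban1985RegularSpaces, (1.41) p.83 (bookkeeping)] -/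
theorem norm_insCfg_restr_le {lo hi : Site d} {A : Site d → Fin d → 𝔸} {a : ℝ} (ha : 0 ≤ a)
    (hA : ∀ x μ, BondIn lo hi x μ → ‖A x μ‖ ≤ a) (x : Site d) (μ : Fin d) :
    ‖insCfg (bondsIn lo hi) (restr (bondsIn lo hi) A) x μ‖ ≤ a := by
  by_cases h : (x, μ) ∈ bondsIn lo hi
  · rw [insCfg_restr_of_mem _ _ h]; exact hA x μ (mem_bondsIn.mp h)
  · simp only [insCfg, h, dite_false, norm_zero]; exact ha

end Locality

/-! ## §2 (1.56) at one bond from the data in the centred box `B^j(c₋) ∪ B^j(c₊)` -/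

section Eq156

variable {𝔸 : Type*} [NormedRing 𝔸] [NormOneClass 𝔸] [NormedAlgebra ℂ 𝔸] [CompleteSpace 𝔸]

/-- ★★ (RECORD TWIN of `B8Eq156KLevelLocal.eq156_loc`.) **(1.56) AT ONE BOND `c = ⟨z, z + e_κ⟩` OF THE `j`-LATTICE FROM BOX DATA, RECORD AVERAGING**: for `U₀` with values in an
averaging-closed `G` (`AvgClosedZ`) whose plaquettes INSIDE the centred `B^j(c₋) ∪ B^j(c₊) = [lo, hi]` obey (1.40) at level `j`, `|U₀(∂p) − 1| < α₀L^{−2j}`, and a field `A` with (1.41)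
`|A(b)| ≤ α₂(Lʲη)⁻¹` on the bonds `b` of that box, under the record windows of `B8Eq156Prop4Rec.eq156_of_141` (odd `L = 2s+1 ≥ 3`, `d ≥ 1`):
`‖Q_j(U₀, ηA)(c) − LʲηQ_jA(c)‖ ≤ (1+2gZ)·2·131072(d+1)²KZ²·e^{4cZα₀}·α₂²`.  Proof: the GLOBAL record theorem for the clamped extension `π^*U₀` and the restriction `A|_{box}`, transported
back by locality (`B7LocalityRec.logCovIterZ_congr`, `linCovIterZ_congr`). [cite: Balaban1985RegularSpaces, (1.56) p.86; Balaban1985Averaging, Prop. 4 p.38, p.24; Balaban1987RG1, (0.4) p.253] -/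
theorem eq156_loc {η : ℝ} (hη : 0 < η) {L s : ℕ} (hLs : L = 2 * s + 1) (hs : 1 ≤ s) (hd : 1 ≤ d) {G : Subgroup 𝔸ˣ} (hG : AvgClosedZ d L G) (j : ℕ)
    (U₀ : Site d → Fin d → 𝔸ˣ) (hU₀ : ∀ x κ, U₀ x κ ∈ G) {α₀ : ℝ} (hα₀ : 0 < α₀)
    (hα3 : C0Z d * α₀ ≤ 1 / 3) (hα4 : 4 * α₀ ≤ c2' d L) (z : Site d) (κ : Fin d)
    (h40 : ∀ (x : Site d) (μ ν : Fin d), μ ≠ ν →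
      PlaqIn (fun i => (L : ℤ) ^ j * z i - (ctrShift L j : ℤ)) (fun i => (L : ℤ) ^ j * z i + (ctrShift L j : ℤ) + if i = κ then (L : ℤ) ^ j else 0) (x, μ, ν) →
      ‖plaqF U₀ μ ν x - 1‖ < α₀ * (((L : ℝ) ^ j)⁻¹) ^ 2)
    (A : Site d → Fin d → 𝔸) {α₂ : ℝ} (hα₂ : 0 ≤ α₂)
    (h41 : ∀ x μ, BondIn (fun i => (L : ℤ) ^ j * z i - (ctrShift L j : ℤ)) (fun i => (L : ℤ) ^ j * z i + (ctrShift L j : ℤ) + if i = κ then (L : ℤ) ^ j else 0) x μ →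
      ‖A x μ‖ ≤ α₂ * ((L : ℝ) ^ j * η)⁻¹)
    (hsmall : Real.exp (4 * cZ d * α₀) * (1 + 2 * (131072 * ((d : ℝ) + 1) ^ 2) * (KZ d L) ^ 2 * α₂) ≤ 2)
    (hc₃ : KZ d L * α₂ ≤ c3 d L) :
    ‖logCovIterZ L U₀ (iEta η A) j z κ - linCovIterZ L U₀ (iEta η A) j z κ‖
      ≤ (1 + 2 * gZ d L) * (2 * (131072 * ((d : ℝ) + 1) ^ 2) * (KZ d L) ^ 2) * Real.exp (4 * cZ d * α₀) * α₂ ^ 2 := by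
  set lo : Site d := fun i => (L : ℤ) ^ j * z i - (ctrShift L j : ℤ) with hlo
  set hi : Site d := fun i => (L : ℤ) ^ j * z i + (ctrShift L j : ℤ) + if i = κ then (L : ℤ) ^ j else 0 with hhi
  have hlohi : ∀ i, lo i ≤ hi i := fun i => by
    have hP : (0 : ℤ) ≤ (L : ℤ) ^ j := by positivity
    have hc : (0 : ℤ) ≤ (ctrShift L j : ℤ) := by positivity
    simp only [hlo, hhi]
    split_ifs <;> linarith
  have hU₀U1 : ∀ x μ, U₀ x μ ∈ U1 𝔸 := fun x μ => hG.le_U1 (hU₀ x μ)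
  have hLr : (0 : ℝ) < (L : ℝ) := by exact_mod_cast (show 0 < L by omega)
  have hpos : 0 < α₀ * (((L : ℝ) ^ j)⁻¹) ^ 2 := mul_pos hα₀ (pow_pos (inv_pos.mpr (pow_pos hLr j)) 2)
  -- the clamped extension `π^*U₀` and its global (1.40) at level `j`
  have hU₀'G : ∀ x μ, clampCfg lo hi U₀ x μ ∈ G := clampCfg_mem hU₀
  have hpdOn : B7Prop1Local.pdevOn lo hi U₀ < α₀ * (((L : ℝ) ^ j)⁻¹) ^ 2 := by
    refine pdevOn_lt_of_forall hpos fun x μ ν hx hx' => ?_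
    rcases eq_or_ne μ ν with rfl | hμν
    · rw [B7Prop2Explicit.hol_plaqWord_self, Units.val_one, sub_self, norm_zero]; exact hpos
    · exact h40 x μ ν hμν ⟨hx, hx'⟩
  have hpdev : pdev (clampCfg lo hi U₀) < α₀ * (((L : ℝ) ^ j)⁻¹) ^ 2 := (pdev_clampCfg_le hlohi hU₀U1).trans_lt hpdOn
  -- the restriction `A|_{box}` and its global (1.41) at level `j`
  have hA' : ∀ x μ, ‖insCfg (bondsIn lo hi) (restr (bondsIn lo hi) A) x μ‖ ≤ α₂ * ((L : ℝ) ^ j * η)⁻¹ :=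
    norm_insCfg_restr_le (by positivity) h41
  -- the global record (1.56) for the modified pair
  have key := eq156_of_141 hη hLs hs hd hG j (clampCfg lo hi U₀) hU₀'G hα₀ hα3 hα4 hpdev (insCfg (bondsIn lo hi) (restr (bondsIn lo hi) A)) hα₂ hA'
    hsmall hc₃ z κ
  -- transport back by locality
  have hagU : AgreeOn lo hi (clampCfg lo hi U₀) U₀ := clampCfg_agree U₀
  have hagA : AgreeOn lo hi (iEta η (insCfg (bondsIn lo hi) (restr (bondsIn lo hi) A))) (iEta η A) := fun x μ hx hxe => by
    show ((Complex.I : ℂ) * η) • insCfg (bondsIn lo hi) (restr (bondsIn lo hi) A) x μ = ((Complex.I : ℂ) * η) • A x μ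
    rw [← agreeOn_insCfg_restr lo hi A x μ hx hxe]
  rw [logCovIterZ_congr hLs j z κ hagU hagA, linCovIterZ_congr hLs j z κ hagU hagA] at key
  exact key

/-! ## §3 «|B₁| < 2dLα₁ + C₂α₂²» at one bond of `Λ_j` -/

/-- (RECORD TWIN of `norm_B1_lt_loc`.) **«|B₁| < 2dLα₁ + C₂ᶻα₂²» AT ONE BOND OF `Λ_j` FROM BOX DATA, RECORD AVERAGING**: under the hypotheses of `eq156_loc` and (1.42)
`‖Q_j(U₀, ηA)(c)‖ < 2dLα₁` at `c`: `‖LʲηQ_jA(c)‖ < 2dLα₁ + C₂ᶻ(d, L, α₀)α₂²`. [cite: Balaban1985RegularSpaces, p.86 (sentence after (1.56)); Balaban1987RG1, (0.4) p.253] -/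
theorem norm_B1_lt_loc {η : ℝ} (hη : 0 < η) {L s : ℕ} (hLs : L = 2 * s + 1) (hs : 1 ≤ s) (hd : 1 ≤ d) {G : Subgroup 𝔸ˣ} (hG : AvgClosedZ d L G) (j : ℕ)
    (U₀ : Site d → Fin d → 𝔸ˣ) (hU₀ : ∀ x κ, U₀ x κ ∈ G) {α₀ : ℝ} (hα₀ : 0 < α₀)
    (hα3 : C0Z d * α₀ ≤ 1 / 3) (hα4 : 4 * α₀ ≤ c2' d L) (z : Site d) (κ : Fin d)
    (h40 : ∀ (x : Site d) (μ ν : Fin d), μ ≠ ν →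
      PlaqIn (fun i => (L : ℤ) ^ j * z i - (ctrShift L j : ℤ)) (fun i => (L : ℤ) ^ j * z i + (ctrShift L j : ℤ) + if i = κ then (L : ℤ) ^ j else 0) (x, μ, ν) →
      ‖plaqF U₀ μ ν x - 1‖ < α₀ * (((L : ℝ) ^ j)⁻¹) ^ 2)
    (A : Site d → Fin d → 𝔸) {α₂ : ℝ} (hα₂ : 0 ≤ α₂)
    (h41 : ∀ x μ, BondIn (fun i => (L : ℤ) ^ j * z i - (ctrShift L j : ℤ)) (fun i => (L : ℤ) ^ j * z i + (ctrShift L j : ℤ) + if i = κ then (L : ℤ) ^ j else 0) x μ →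
      ‖A x μ‖ ≤ α₂ * ((L : ℝ) ^ j * η)⁻¹)
    (hsmall : Real.exp (4 * cZ d * α₀) * (1 + 2 * (131072 * ((d : ℝ) + 1) ^ 2) * (KZ d L) ^ 2 * α₂) ≤ 2)
    (hc₃ : KZ d L * α₂ ≤ c3 d L) {α₁ : ℝ} (h42 : ‖logCovIterZ L U₀ (iEta η A) j z κ‖ < 2 * d * L * α₁) :
    ‖linCovIterZ L U₀ (iEta η A) j z κ‖
      < 2 * d * L * α₁ + (1 + 2 * gZ d L) * (2 * (131072 * ((d : ℝ) + 1) ^ 2) * (KZ d L) ^ 2) * Real.exp (4 * cZ d * α₀) * α₂ ^ 2 := by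
  have hC := eq156_loc hη hLs hs hd hG j U₀ hU₀ hα₀ hα3 hα4 z κ h40 A hα₂ h41 hsmall hc₃
  calc ‖linCovIterZ L U₀ (iEta η A) j z κ‖
      = ‖logCovIterZ L U₀ (iEta η A) j z κ - (logCovIterZ L U₀ (iEta η A) j z κ - linCovIterZ L U₀ (iEta η A) j z κ)‖ := by
        rw [sub_sub_cancel]
    _ ≤ ‖logCovIterZ L U₀ (iEta η A) j z κ‖ + ‖logCovIterZ L U₀ (iEta η A) j z κ - linCovIterZ L U₀ (iEta η A) j z κ‖ := norm_sub_le _ _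
    _ < _ := add_lt_add_of_lt_of_le h42 hC

end Eq156

/-! ## §4 The k-level form «on Λ_j, j = 0, 1, …, k» for a general family `{Ω_j}` (centred boxes) -/

section KLevel

variable {𝔸 : Type*} [NormedRing 𝔸] [NormOneClass 𝔸] [NormedAlgebra ℂ 𝔸] [CompleteSpace 𝔸]

/-- (RECORD TWIN of `norm_B1_lt_kLevel`.) **«|B₁| < 2dLα₁ + C₂ᶻα₂²» AT EVERY BOND OF EVERY `Λ_j`, `j ≤ k`, FROM THE LEVEL-WISE (1.40)∕(1.41)∕(1.42)**, record averaging: let `Ω`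
be the site domains and `Λ` the constraint bonds of the `j`-lattices, with every site of the CENTRED box `B^j(c₋) ∪ B^j(c₊)` of a `c ∈ Λ_j` in `Ω_j` («Λ_j ⊂ Ω_j^{(j)}», (1.5), centred blocks
[I] (0.3) — hypothesis `hbox`); if `U₀ ∈ 𝔄_k({Ω_j}, α₀)` (`InAk`), (1.41) `|A(b)| ≤ α₂(Lʲη)⁻¹` on the bonds touching `Ω_j`, and (1.42) `‖Q_j(U₀, ηA)(c)‖ < 2dLα₁` on `Λ_j`, then
`‖LʲηQ_jA(c)‖ < 2dLα₁ + C₂ᶻα₂²` for every `c ∈ Λ_j`, `j ≤ k`. [cite: Balaban1985RegularSpaces, p.86 (sentence after (1.56)), (1.40)–(1.42) p.83, (1.5) p.77; Balaban1987RG1, (0.3)–(0.4) pp.252–253] -/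
theorem norm_B1_lt_kLevel {η : ℝ} (hη : 0 < η) {L s : ℕ} (hLs : L = 2 * s + 1) (hs : 1 ≤ s) (hd : 1 ≤ d) {G : Subgroup 𝔸ˣ} (hG : AvgClosedZ d L G) {k : ℕ}
    (U₀ : Site d → Fin d → 𝔸ˣ) (hU₀ : ∀ x κ, U₀ x κ ∈ G) {α₀ : ℝ} (hα₀ : 0 < α₀)
    (hα3 : C0Z d * α₀ ≤ 1 / 3) (hα4 : 4 * α₀ ≤ c2' d L) (A : Site d → Fin d → 𝔸) {α₂ : ℝ} (hα₂ : 0 ≤ α₂)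
    (hsmall : Real.exp (4 * cZ d * α₀) * (1 + 2 * (131072 * ((d : ℝ) + 1) ^ 2) * (KZ d L) ^ 2 * α₂) ≤ 2)
    (hc₃ : KZ d L * α₂ ≤ c3 d L) {Ω : ℕ → Set (Site d)} {Λ : ℕ → Set (Site d × Fin d)}
    (hbox : ∀ j, j ≤ k → ∀ c ∈ Λ j, ∀ x,
      InBox (fun i => (L : ℤ) ^ j * c.1 i - (ctrShift L j : ℤ)) (fun i => (L : ℤ) ^ j * c.1 i + (ctrShift L j : ℤ) + if i = c.2 then (L : ℤ) ^ j else 0) x → x ∈ Ω j)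
    (h40 : InAk L k η α₀ Ω U₀)
    (h41 : ∀ j, j ≤ k → ∀ x μ, BondTouches (Ω j) x μ → ‖A x μ‖ ≤ α₂ * ((L : ℝ) ^ j * η)⁻¹)
    {α₁ : ℝ} (h42 : ∀ j, j ≤ k → ∀ c ∈ Λ j, ‖logCovIterZ L U₀ (iEta η A) j c.1 c.2‖ < 2 * d * L * α₁)
    {j : ℕ} (hj : j ≤ k) {c : Site d × Fin d} (hc : c ∈ Λ j) :
    ‖linCovIterZ L U₀ (iEta η A) j c.1 c.2‖
      < 2 * d * L * α₁ + (1 + 2 * gZ d L) * (2 * (131072 * ((d : ℝ) + 1) ^ 2) * (KZ d L) ^ 2) * Real.exp (4 * cZ d * α₀) * α₂ ^ 2 := by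
  refine norm_B1_lt_loc hη hLs hs hd hG j U₀ hU₀ hα₀ hα3 hα4 c.1 c.2 (fun x μ ν hμν hp => ?_) A hα₂
    (fun x μ hb => ?_) hsmall hc₃ (h42 j hj c hc)
  · -- the plaquette lies in the box, hence touches `Ω_j`: (1.7) at level `j`
    exact (h40 j hj).1 x μ ν hμν (Or.inl (hbox j hj c hc x hp.1))
  · -- the bond lies in the box, hence touches `Ω_j`: (1.41) at level `j`
    exact h41 j hj x μ (Or.inl (hbox j hj c hc x hb.1))

/-- (RECORD TWIN of `wsup_B1_le_kLevel`.) **«|B₁| ≤ 2dLα₁ + C₂ᶻα₂²» FOR THE k-LEVEL SUPREMUM** `|B₁| = sup_{j ≤ k} sup_{c ∈ Λ_j}‖LʲηQ_jA(c)‖` (weight-`1` `wsup` over `{(j, c) : j ≤ k, c ∈ Λ_j}`),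
same hypotheses (`α₁ ≥ 0`), record averaging. [cite: Balaban1985RegularSpaces, p.86 (sentence after (1.56)); Balaban1987RG1, (0.4) p.253] -/
theorem wsup_B1_le_kLevel {η : ℝ} (hη : 0 < η) {L s : ℕ} (hLs : L = 2 * s + 1) (hs : 1 ≤ s) (hd : 1 ≤ d) {G : Subgroup 𝔸ˣ} (hG : AvgClosedZ d L G) {k : ℕ}
    (U₀ : Site d → Fin d → 𝔸ˣ) (hU₀ : ∀ x κ, U₀ x κ ∈ G) {α₀ : ℝ} (hα₀ : 0 < α₀)
    (hα3 : C0Z d * α₀ ≤ 1 / 3) (hα4 : 4 * α₀ ≤ c2' d L) (A : Site d → Fin d → 𝔸) {α₂ : ℝ} (hα₂ : 0 ≤ α₂)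
    (hsmall : Real.exp (4 * cZ d * α₀) * (1 + 2 * (131072 * ((d : ℝ) + 1) ^ 2) * (KZ d L) ^ 2 * α₂) ≤ 2)
    (hc₃ : KZ d L * α₂ ≤ c3 d L) {Ω : ℕ → Set (Site d)} {Λ : ℕ → Set (Site d × Fin d)}
    (hbox : ∀ j, j ≤ k → ∀ c ∈ Λ j, ∀ x,
      InBox (fun i => (L : ℤ) ^ j * c.1 i - (ctrShift L j : ℤ)) (fun i => (L : ℤ) ^ j * c.1 i + (ctrShift L j : ℤ) + if i = c.2 then (L : ℤ) ^ j else 0) x → x ∈ Ω j)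
    (h40 : InAk L k η α₀ Ω U₀)
    (h41 : ∀ j, j ≤ k → ∀ x μ, BondTouches (Ω j) x μ → ‖A x μ‖ ≤ α₂ * ((L : ℝ) ^ j * η)⁻¹)
    {α₁ : ℝ} (hα₁ : 0 ≤ α₁) (h42 : ∀ j, j ≤ k → ∀ c ∈ Λ j, ‖logCovIterZ L U₀ (iEta η A) j c.1 c.2‖ < 2 * d * L * α₁) :
    wsup 1 (fun p : {p : ℕ × (Site d × Fin d) // p.1 ≤ k ∧ p.2 ∈ Λ p.1} => linCovIterZ L U₀ (iEta η A) p.1.1 p.1.2.1 p.1.2.2)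
      ≤ 2 * d * L * α₁ + (1 + 2 * gZ d L) * (2 * (131072 * ((d : ℝ) + 1) ^ 2) * (KZ d L) ^ 2) * Real.exp (4 * cZ d * α₀) * α₂ ^ 2 := by
  have hL1 : (1 : ℝ) ≤ L := by exact_mod_cast (show 1 ≤ L by omega)
  have hg : 0 ≤ gZ d L := B7Prop4GeneralLevelsRec.gZ_nonneg d L
  refine wsup_le (fun p => ?_) (by positivity)
  rw [one_mul]
  exact (norm_B1_lt_kLevel hη hLs hs hd hG U₀ hU₀ hα₀ hα3 hα4 A hα₂ hsmall hc₃ hbox h40 h41 h42 p.2.1 p.2.2).le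

end KLevel

end Literature.MathematicalPhysics.QuantumFieldTheory.Balaban1983to89.B8Eq156KLevelLocalRec
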